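import Summits.QuantumFields.BalabanUV.Beta.GAN24.T2DevConservationEnd
import Summits.QuantumFields.BalabanUV.Beta.GAN24.T2UndressedCombShapeEnd

/-!
# `BalabanUV.Beta.GAN24.T2UndressedCombJunction` — binder row G-an2-4 ∕ (CONV-C), CT-W route of record «WC-TL» (RULING R-gan24p1-g24-1, journal l.38843):
# **THE A-0 END IN DEVIATION FORM WITH ROW (U) DISCHARGED BY NAME — «T2Shape»(E, d = 3, pin) ⟸ F2a-comb ∧ (C)sym ∧ (H)**
# = leaf-01 g62's `T2DevConservationEnd.t2Shape_T2RecAt_three_of_U_C_H` (p315210 ✓) ∘ this lineage's (B) `T2UndressedCombShapeEnd.t2Shape_undressedComb_three_of_F2a` (p314162 ✓)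

NOT IN PRINT; OUR BOOKKEEPING ([folklore] ONE `obtain … exact` — a by-name junction, 0 new content; G-an2-4 formalisation swarm, leaf prover
`b2b-balaban-gan24-formalise-leaf-04` gen 59 = the owner of row (U) per leaf-01 g62's close l.≈39030 «three rows named and owned ((U) leaf-04, (C) an2, (H) the
OWNER's WC-TL chain)»; name PROVISIONAL).  HONEST FRAMING (cell contract, verbatim): «discharging `BetaPertH` makes Bałaban's UV stability UNCONDITIONAL — a real
constructive-QFT result; it is NOT the continuum limit and NOT the Clay problem.»  HONEST DEPENDENCY (verbatim): «continuum YM on T⁴ ⇐ BetaPertH ∧ nine spine estimates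
(0/9 proved); BetaPertH ⇐ (D1) ∧ (D4) ∧ CAP+tail; G-an2-4 gates asym, D1 and NE2/3/4.»

WHAT.  **`t2Shape_T2RecAt_three_of_F2a_C_H`** (`d = 3`, `2 ≤ Lc`, in-block root, `cE = Lc⁴`, pin `|cE₂| ≤ Lc⁸`, every `cVH cΛ cB Tc`, off-diagonal covariant
`LocStencil₂` border): F2a-comb `hZ` ((B)'s binder, token for token) ∧ (C)sym `hC` ∧ (H) `hH` (leaf-01's binders, token for token) ⟹ `∃ C δ, 0 < δ ∧ ∀ n, LocStencil₂ (T̃_n) C δ`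
— «T2Shape» of an2's DRESSED comb T₂ tower.  The three rows that remain are exactly the OWNER's WC-TL rows: F2a-comb (the reference tower's source zero modes —
numerically ✓ at m = 0, 1, D = 2, R4∕R4b; nobody's theorem yet), (C)sym (an2's WANTED conservation law, W8 ∕ W-gan24p1-g24-9), (H) (the OWNER's (SLAVE) + (Q-R) + (Q-b)
chain — THE located crux).  Discharges NOTHING else; NOTHING of «T2Drift»(E) ∕ (hW, hWall); NEVER «G-an2-4 closed» as (CONV-C); NOT D1, NOT `BetaPertH`, NOT continuum,
NOT Clay; not in print — our bookkeeping.  0 `def`, 0 cite, 0 `def … : Prop`, 0 sorry.  2026-08-22.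
-/

noncomputable section

open Finset
open scoped BigOperators
open Literature.MathematicalPhysics.QuantumFieldTheory
open Literature.MathematicalPhysics.QuantumFieldTheory.Balaban1983to89
open Literature.MathematicalPhysics.QuantumFieldTheory.Balaban1983to89.Beta
open ExpKernelCalculus (MKer Decays shiftK)
open OneStepResolventKernel (Fib LocStencil)
open OneStepKernelFamily (KInvStep)
open AffineAveraging (box toSite)
open AveragingMixedJetTables (mixFFAt)
open SecondOrderResponse (W2SymOfK)
open BalabanCompositeJets (LocStencil₂)
open BalabanStepJetsSucc (mmRead)
open BalabanStepW2 (K3OfK M2Of)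
open Summit.QuantumFields.BalabanUV.Beta.HessKerDressedUnits (unitK unitS)
open Summit.QuantumFields.BalabanUV.Beta.SecondOrderUnits (unitM unitS₂ unitM₂)
open Summit.QuantumFields.BalabanUV.Beta.AxialDressingRooted (coDressKBmAt)
open Summit.QuantumFields.BalabanUV.Beta.SpineRooted (T2RecOf T2RecAt SpureRecAt M1At)
open Summit.QuantumFields.BalabanUV.Beta.GAN24.CombesThomas (sfStep smStep)
open Summit.QuantumFields.BalabanUV.Beta.GAN24.T2RecursionAffine (lin4)
open Summit.QuantumFields.BalabanUV.Beta.GAN24.BiStencilZeroMode (Tab zmode)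
open Summit.QuantumFields.BalabanUV.Beta.GAN24.T2DevConservationEnd (t2Shape_T2RecAt_three_of_U_C_H)
open Summit.QuantumFields.BalabanUV.Beta.GAN24.T2UndressedCombShapeEnd (t2Shape_undressedComb_three_of_F2a)

namespace Summit.QuantumFields.BalabanUV.Beta.GAN24.T2UndressedCombJunction

variable {Lc : ℕ} [NeZero Lc] {r : Fin (3 + 1) → ℕ}

/-- NOT IN PRINT; OUR BOOKKEEPING ([folklore] by-name junction).  **«T2Shape» OF an2's DRESSED COMB T₂ TOWER (`d = 3`, pin) ⟸ F2a-comb ∧ (C)sym ∧ (H)**: leaf-01 g62's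
A-0 END `t2Shape_T2RecAt_three_of_U_C_H` with its row (U) supplied by (B) `t2Shape_undressedComb_three_of_F2a`; the binders `hZ` (F2a-comb), `hC` ((C)sym) and
`hH` ((H)) are the two source files' binders TOKEN FOR TOKEN. -/
theorem t2Shape_T2RecAt_three_of_F2a_C_H (hLc : 2 ≤ Lc) (hr : r ∈ box (3 + 1) Lc) {cE : ℝ} (hcE : cE = (Lc : ℝ) ^ (3 + 1)) (cVH cΛ cE₂ cB : ℝ)
    (Tc : Fin 4 → Fin 4 → Fin 4 → Fin 4 → ℝ) {vh₂S : Tab 3}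
    (hBff : ∀ κ u κ' u' x z (α β : Fin (3 + 1)), vh₂S κ u κ' u' x z (Sum.inl α) (Sum.inl β) = 0)
    (hBmm : ∀ κ u κ' u' x z (μ ν : Fin (3 + 1)), vh₂S κ u κ' u' x z (Sum.inr μ) (Sum.inr ν) = 0)
    {CB δB : ℝ} (hB : LocStencil₂ vh₂S CB δB) (hδB : 0 < δB)
    (hBt : ∀ (κ : Fin (3 + 1)) (u : Fin (3 + 1) → ℤ) (κ' : Fin (3 + 1)) (u' t : Fin (3 + 1) → ℤ),
      vh₂S κ (u + (Lc : ℤ) • t) κ' (u' + (Lc : ℤ) • t) = shiftK (-((Lc : ℤ) • t)) (vh₂S κ u κ' u'))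
    (hpin : |cE₂| ≤ (Lc : ℝ) ^ (2 * (3 + 1)))
    (hZ : ∀ i : ℕ,
      (∀ κ u κ' u' t,
          (cE₂ * (Lc : ℝ) ^ (2 * (3 + 1))) • mmRead Lc (K3OfK (unitK (sfStep Lc i) (smStep 3 Lc i) (KInvStep (d := 3) Lc i)) Lc (unitS (sfStep Lc i) (smStep 3 Lc i) (SpureRecAt 3 Lc (toSite r) cE cVH cΛ i)) (unitM (sfStep Lc i)
              (smStep 3 Lc i) (M1At 3 Lc (toSite r) cΛ i)) (W2SymOfK (unitK (sfStep Lc i) (smStep 3 Lc i) (KInvStep (d := 3) Lc i)) Lc (unitS (sfStep Lc i) (smStep 3 Lc i) (SpureRecAt 3 Lc (toSite r) cE cVH cΛ i)) (unitM (sfStep Lc i)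
              (smStep 3 Lc i) (M1At 3 Lc (toSite r) cΛ i)) 0 (unitM₂ (sfStep Lc i) (smStep 3 Lc i) (M2Of 3 Lc (mixFFAt (toSite r) Lc) i))) κ (u + (Lc : ℤ) • t) κ' (u' + (Lc : ℤ) • t)) + cB • vh₂S κ (u + (Lc : ℤ) • t) κ' (u' + (Lc : ℤ)
              • t) =
        shiftK (-((Lc : ℤ) • t)) ((cE₂ * (Lc : ℝ) ^ (2 * (3 + 1))) • mmRead Lc (K3OfK (unitK (sfStep Lc i) (smStep 3 Lc i) (KInvStep (d := 3) Lc i)) Lc (unitS (sfStep Lc i) (smStep 3 Lc i) (SpureRecAt 3 Lc (toSite r) cE cVH cΛ i))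
            (unitM (sfStep Lc i) (smStep 3 Lc i) (M1At 3 Lc (toSite r) cΛ i)) (W2SymOfK (unitK (sfStep Lc i) (smStep 3 Lc i) (KInvStep (d := 3) Lc i)) Lc (unitS (sfStep Lc i) (smStep 3 Lc i) (SpureRecAt 3 Lc (toSite r) cE cVH cΛ i))
            (unitM (sfStep Lc i) (smStep 3 Lc i) (M1At 3 Lc (toSite r) cΛ i)) 0 (unitM₂ (sfStep Lc i) (smStep 3 Lc i) (M2Of 3 Lc (mixFFAt (toSite r) Lc) i))) κ u κ' u') + cB • vh₂S κ u κ' u')) ∧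
      (∀ κ κ' κ₁ κ₂,
        zmode Lc (fun κ u κ' u' => (cE₂ * (Lc : ℝ) ^ (2 * (3 + 1))) • mmRead Lc (K3OfK (unitK (sfStep Lc i) (smStep 3 Lc i) (KInvStep (d := 3) Lc i)) Lc (unitS (sfStep Lc i) (smStep 3 Lc i) (SpureRecAt 3 Lc (toSite r) cE cVH cΛ i))
            (unitM (sfStep Lc i) (smStep 3 Lc i) (M1At 3 Lc (toSite r) cΛ i)) (W2SymOfK (unitK (sfStep Lc i) (smStep 3 Lc i) (KInvStep (d := 3) Lc i)) Lc (unitS (sfStep Lc i) (smStep 3 Lc i) (SpureRecAt 3 Lc (toSite r) cE cVH cΛ i))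
            (unitM (sfStep Lc i) (smStep 3 Lc i) (M1At 3 Lc (toSite r) cΛ i)) 0 (unitM₂ (sfStep Lc i) (smStep 3 Lc i) (M2Of 3 Lc (mixFFAt (toSite r) Lc) i))) κ u κ' u') + cB • vh₂S κ u κ' u') κ κ' (Sum.inl κ₁) (Sum.inl κ₂) +
        zmode Lc (fun κ u κ' u' => (cE₂ * (Lc : ℝ) ^ (2 * (3 + 1))) • mmRead Lc (K3OfK (unitK (sfStep Lc i) (smStep 3 Lc i) (KInvStep (d := 3) Lc i)) Lc (unitS (sfStep Lc i) (smStep 3 Lc i) (SpureRecAt 3 Lc (toSite r) cE cVH cΛ i))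
            (unitM (sfStep Lc i) (smStep 3 Lc i) (M1At 3 Lc (toSite r) cΛ i)) (W2SymOfK (unitK (sfStep Lc i) (smStep 3 Lc i) (KInvStep (d := 3) Lc i)) Lc (unitS (sfStep Lc i) (smStep 3 Lc i) (SpureRecAt 3 Lc (toSite r) cE cVH cΛ i))
            (unitM (sfStep Lc i) (smStep 3 Lc i) (M1At 3 Lc (toSite r) cΛ i)) 0 (unitM₂ (sfStep Lc i) (smStep 3 Lc i) (M2Of 3 Lc (mixFFAt (toSite r) Lc) i))) κ u κ' u') + cB • vh₂S κ u κ' u') κ' κ (Sum.inl κ₁) (Sum.inl κ₂) = 0))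
    {Ch δh : ℝ} (hδh : 0 < δh)
    (hC : ∀ (i : ℕ) (κ κ' κ₁ κ₂ : Fin (3 + 1)),
      zmode Lc (unitS₂ (sfStep Lc i) (smStep 3 Lc i) (T2RecAt 3 Lc (toSite r) cE cVH cΛ cE₂ cB Tc vh₂S (mixFFAt (toSite r) Lc) i)) κ κ' (Sum.inl κ₁) (Sum.inl κ₂)
          + zmode Lc (unitS₂ (sfStep Lc i) (smStep 3 Lc i) (T2RecAt 3 Lc (toSite r) cE cVH cΛ cE₂ cB Tc vh₂S (mixFFAt (toSite r) Lc) i)) κ' κ (Sum.inl κ₁) (Sum.inl κ₂)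
        = zmode Lc (unitS₂ (sfStep Lc i) (smStep 3 Lc i) (T2RecOf 3 Lc (fun j => KInvStep (d := 3) Lc j) (SpureRecAt 3 Lc (toSite r) cE cVH cΛ) (M1At 3 Lc (toSite r) cΛ) cE₂ cB Tc vh₂S (mixFFAt (toSite r) Lc) i)) κ κ' (Sum.inl κ₁)
            (Sum.inl κ₂)
          + zmode Lc (unitS₂ (sfStep Lc i) (smStep 3 Lc i) (T2RecOf 3 Lc (fun j => KInvStep (d := 3) Lc j) (SpureRecAt 3 Lc (toSite r) cE cVH cΛ) (M1At 3 Lc (toSite r) cΛ) cE₂ cB Tc vh₂S (mixFFAt (toSite r) Lc) i)) κ' κ (Sum.inl κ₁)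
              (Sum.inl κ₂))
    (hH : ∀ m : ℕ, LocStencil₂ (((lin4 (cE₂ * (Lc : ℝ) ^ (2 * (3 + 1))) (unitK (sfStep Lc m) (smStep 3 Lc m) (coDressKBmAt (toSite r) Lc (KInvStep (d := 3) Lc m))) Lc
            (unitS₂ (sfStep Lc m) (smStep 3 Lc m) (T2RecAt 3 Lc (toSite r) cE cVH cΛ cE₂ cB Tc vh₂S (mixFFAt (toSite r) Lc) m)) -
          lin4 (cE₂ * (Lc : ℝ) ^ (2 * (3 + 1))) (unitK (sfStep Lc m) (smStep 3 Lc m) (KInvStep (d := 3) Lc m)) Lc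
            (unitS₂ (sfStep Lc m) (smStep 3 Lc m) (T2RecAt 3 Lc (toSite r) cE cVH cΛ cE₂ cB Tc vh₂S (mixFFAt (toSite r) Lc) m))) +
        ((fun κ u κ' u' => (cE₂ * (Lc : ℝ) ^ (2 * (3 + 1))) • mmRead Lc (K3OfK (unitK (sfStep Lc m) (smStep 3 Lc m) (coDressKBmAt (toSite r) Lc (KInvStep (d := 3) Lc m))) Lc
            (unitS (sfStep Lc m) (smStep 3 Lc m) (SpureRecAt 3 Lc (toSite r) cE cVH cΛ m)) (unitM (sfStep Lc m) (smStep 3 Lc m) (M1At 3 Lc (toSite r) cΛ m))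
            (W2SymOfK (unitK (sfStep Lc m) (smStep 3 Lc m) (coDressKBmAt (toSite r) Lc (KInvStep (d := 3) Lc m))) Lc (unitS (sfStep Lc m) (smStep 3 Lc m) (SpureRecAt 3 Lc (toSite r) cE cVH cΛ m))
              (unitM (sfStep Lc m) (smStep 3 Lc m) (M1At 3 Lc (toSite r) cΛ m)) 0 (unitM₂ (sfStep Lc m) (smStep 3 Lc m) (M2Of 3 Lc (mixFFAt (toSite r) Lc) m))) κ u κ' u')
          + cB • vh₂S κ u κ' u') -
         (fun κ u κ' u' => (cE₂ * (Lc : ℝ) ^ (2 * (3 + 1))) • mmRead Lc (K3OfK (unitK (sfStep Lc m) (smStep 3 Lc m) (KInvStep (d := 3) Lc m)) Lc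
            (unitS (sfStep Lc m) (smStep 3 Lc m) (SpureRecAt 3 Lc (toSite r) cE cVH cΛ m)) (unitM (sfStep Lc m) (smStep 3 Lc m) (M1At 3 Lc (toSite r) cΛ m))
            (W2SymOfK (unitK (sfStep Lc m) (smStep 3 Lc m) (KInvStep (d := 3) Lc m)) Lc (unitS (sfStep Lc m) (smStep 3 Lc m) (SpureRecAt 3 Lc (toSite r) cE cVH cΛ m))
              (unitM (sfStep Lc m) (smStep 3 Lc m) (M1At 3 Lc (toSite r) cΛ m)) 0 (unitM₂ (sfStep Lc m) (smStep 3 Lc m) (M2Of 3 Lc (mixFFAt (toSite r) Lc) m))) κ u κ' u')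
          + cB • vh₂S κ u κ' u')))) Ch δh) :
    ∃ C δ : ℝ, 0 < δ ∧ ∀ n : ℕ, LocStencil₂ (unitS₂ (sfStep Lc n) (smStep 3 Lc n) (T2RecAt 3 Lc (toSite r) cE cVH cΛ cE₂ cB Tc vh₂S (mixFFAt (toSite r) Lc) n)) C δ := by
  obtain ⟨C₂, δ₂, hδ₂, hT⟩ := t2Shape_undressedComb_three_of_F2a hLc hr hcE cVH cΛ cE₂ cB Tc hBff hBmm hB hδB hpin hZ
  exact t2Shape_T2RecAt_three_of_U_C_H hLc hr cE cVH cΛ cE₂ cB Tc hBff hBmm ⟨CB, δB, hδB, hB⟩ hBt hpin hδ₂ hδh hT hC hH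

end Summit.QuantumFields.BalabanUV.Beta.GAN24.T2UndressedCombJunction

end
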